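import Mathlib.Analysis.Complex.Basic
import Mathlib.Analysis.SpecialFunctions.Complex.CircleMap
import Mathlib.MeasureTheory.Integral.CircleIntegral
import Mathlib.AlgebraicTopology.FundamentalGroupoid.SimplyConnected
import Mathlib.Analysis.Convex.PathConnected
import Mathlib.Analysis.Normed.Module.RCLike.Real
import Mathlib.Algebra.Field.Periodic
import Mathlib.Order.Hom.Basic
import HarnessLib

-- provenance: harness21/H21/H21/Prelude/Stoch/PlanarDomains.lean @ 399d27b (interim HEAD d8f2665); M5 mechanical rewrite
/-!
# Planar Jordan domains with marked boundary points (trunk `Stoch`)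

This prelude file provides the planar domains on which crossing probabilities (Cardy–Smirnov),
interfaces (chordal SLE, Dobrushin boundary conditions) and conformal invariance statements of
two-dimensional critical lattice models are formulated.

* `Literature.Probability.RandomPlanarGeometry.JordanDomain`: a bounded simply connected planar domain given as DATA: an open bounded
  connected `carrier : Set ℂ` together with a continuous `1`-periodic parametrisation
  `boundary : ℝ → ℂ` of its frontier, injective on `Set.Ico 0 1`. Packaging the boundary loop as data
  avoids any appeal to the Jordan curve theorem (not in Mathlib); the consequences that need
  Jordan–Schoenflies (`JordanDomain.isSimplyConnected`) are stated as sorried theorems.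
* `Literature.MarkedDomain n`: a Jordan domain with `n` marked boundary points, given by strictly increasing
  parameters `mark : Fin n → ℝ` in `Set.Ico 0 1`; `Literature.ConformalRectangle := MarkedDomain 4`
  (topological rectangle `(D; a, b, c, d)`) and `Literature.DobrushinDomain := MarkedDomain 2`
  (domain with two marked points `(D; a, b)`). Marked points `MarkedDomain.pt`, boundary arcs
  `MarkedDomain.arc i` (from `pt i` to `pt (i+1)`, cyclically), sub-markings `restrictMarks`, `chord`.
* Non-vacuity: `JordanDomain.unitDisc`, `ConformalRectangle.unitDisc`, `DobrushinDomain.unitDisc` are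
  genuine constructions (all fields proved) and give `Nonempty` instances.

## Mathlib

We use `IsOpen`, `Bornology.IsBounded`, `IsConnected`, `frontier`, `Function.Periodic`, `Set.InjOn`,
`IsSimplyConnected`, `circleMap` (`range_circleMap`, `periodic_circleMap`,
`injOn_circleMap_of_abs_sub_le'`), `frontier_ball`, `Convex.isPathConnected`. Mathlib has no notion of
Jordan domain / marked domain / conformal rectangle.

## Design choices

* Orientation of the boundary loop is deliberately NOT encoded (outline D4): cross-ratios, crossing
  events and chordal SLE are invariant under reversal of the parametrisation.
* `MarkedDomain.nextMark` wraps around using the period: the last arc is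
  `boundary '' Icc (mark (n-1)) (mark 0 + 1)`.

## References

* S. Smirnov, *Critical percolation in the plane: conformal invariance, Cardy's formula, scaling
  limits*, C. R. Acad. Sci. Paris Sér. I Math. 333 (2001), 239–244.
* W. Werner, *Lectures on two-dimensional critical percolation*, IAS/Park City (2007), §2–3.
-/

open Set Real

namespace Literature.Probability.RandomPlanarGeometry

/-- A **Jordan domain**: a bounded open connected planar set `carrier` together with a continuous
`1`-periodic loop `boundary : ℝ → ℂ`, injective on one period `Ico 0 1`, whose range is exactly the
topological frontier of `carrier`. The Jordan curve is thus part of the data (no Jordan curve theorem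
is used). Cf. Werner, *Lectures on two-dimensional critical percolation* (2007), §2. [folklore] -/
structure JordanDomain where
  /-- The open domain `D ⊆ ℂ`. -/
  carrier : Set ℂ
  /-- A `1`-periodic parametrisation of the boundary Jordan curve `∂D`. -/
  boundary : ℝ → ℂ
  /-- `D` is open. -/
  isOpen : IsOpen carrier
  /-- `D` is bounded. -/
  isBounded : Bornology.IsBounded carrier
  /-- `D` is connected (in particular nonempty). -/
  isConnected : IsConnected carrier
  /-- The boundary parametrisation is continuous. -/
  continuous_boundary : Continuous boundary
  /-- The boundary parametrisation is `1`-periodic. -/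
  periodic_boundary : boundary.Periodic 1
  /-- The boundary parametrisation is injective on one period (simple closed curve). -/
  injOn_boundary : InjOn boundary (Ico 0 1)
  /-- The boundary loop traces exactly the frontier of `D`. -/
  range_boundary : range boundary = frontier carrier

namespace JordanDomain

variable (D : JordanDomain)

/-- Every boundary point `boundary t` lies on the frontier of the domain
(Werner 2007, §2). [cite: Werner2007, §2] -/
theorem boundary_mem_frontier (t : ℝ) : D.boundary t ∈ frontier D.carrier := by
  rw [← D.range_boundary]
  exact mem_range_self t

/-- A Jordan domain is nonempty (it is connected) (Werner 2007, §2). [cite: Werner2007, §2] -/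
theorem nonempty : D.carrier.Nonempty :=
  D.isConnected.nonempty

/-- A Jordan domain is a proper subset of the plane (it is bounded) (Werner 2007, §2). [cite: Werner2007, §2] -/
theorem carrier_ne_univ : D.carrier ≠ univ := by
  intro h
  have hb := D.isBounded
  rw [h] at hb
  exact NormedSpace.unbounded_univ ℝ ℂ hb

/-- By periodicity, the frontier is already the image of one period `Ico 0 1`
(Werner 2007, §2). [cite: Werner2007, §2] -/
theorem frontier_eq_image_Ico : frontier D.carrier = D.boundary '' Ico 0 1 := by
  rw [← D.range_boundary]
  refine ((range_subset_iff.2 fun x ↦ ?_).antisymm (image_subset_range _ _))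
  obtain ⟨y, hy, hyx⟩ := D.periodic_boundary.exists_mem_Ico one_pos x 0
  exact ⟨y, by simpa using hy, hyx.symm⟩

/-- The closure of a Jordan domain is the domain together with its boundary curve
(Werner 2007, §2). [cite: Werner2007, §2] -/
theorem closure_eq : closure D.carrier = D.carrier ∪ range D.boundary := by
  rw [D.range_boundary, closure_eq_self_union_frontier]

/-- A Jordan domain is simply connected. This is a consequence of the Jordan–Schoenflies theorem
(the interior of a Jordan curve is homeomorphic to a disc); see e.g. Pommerenke,
*Boundary behaviour of conformal maps* (1992), §2.2, and Werner (2007), §2. [cite: Werner2007] -/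
def isSimplyConnected : Prop :=
  IsSimplyConnected D.carrier

/-- The open **unit disc** as a Jordan domain, with boundary the unit circle parametrised by
`t ↦ exp (2πit)`. This makes every `∀ D : JordanDomain, …` statement non-vacuous
(Smirnov, C. R. Acad. Sci. 333 (2001); Werner 2007, §2). [cite: Werner2007, §2] -/
noncomputable def unitDisc : JordanDomain where
  carrier := Metric.ball 0 1
  boundary t := circleMap 0 1 (2 * π * t)
  isOpen := Metric.isOpen_ball
  isBounded := Metric.isBounded_ball
  isConnected := ((convex_ball (0 : ℂ) 1).isPathConnected (by simp)).isConnected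
  continuous_boundary := (continuous_circleMap 0 1).comp (continuous_const.mul continuous_id)
  periodic_boundary t := by
    simp only
    rw [mul_add, mul_one]
    exact periodic_circleMap 0 1 _
  injOn_boundary := by
    intro s hs t ht h
    have hinj := injOn_circleMap_of_abs_sub_le' (c := 0) (a := 0) (b := 2 * π) one_ne_zero (by simp)
    have key : 2 * π * s = 2 * π * t :=
      hinj ⟨by nlinarith [pi_pos, hs.1], by nlinarith [pi_pos, hs.2]⟩
        ⟨by nlinarith [pi_pos, ht.1], by nlinarith [pi_pos, ht.2]⟩ h
    exact mul_left_cancel₀ (by positivity) key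
  range_boundary := by
    have hs : Function.Surjective fun t : ℝ ↦ 2 * π * t := fun y ↦
      ⟨y / (2 * π), by field_simp⟩
    rw [frontier_ball _ one_ne_zero, show (fun t : ℝ ↦ circleMap 0 1 (2 * π * t)) =
      circleMap 0 1 ∘ fun t : ℝ ↦ 2 * π * t from rfl, hs.range_comp, range_circleMap, abs_one]

/-- The carrier of the unit disc Jordan domain is the open unit ball (by definition). [folklore] -/
@[simp] theorem carrier_unitDisc : unitDisc.carrier = Metric.ball 0 1 := rfl

/-- Jordan domains exist: the unit disc (non-vacuity of `∀ D : JordanDomain, …` statements). [folklore] -/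
instance : Nonempty JordanDomain := ⟨unitDisc⟩

end JordanDomain

/-- A **marked domain**: a Jordan domain together with `n` marked boundary points, given by strictly
increasing boundary parameters `mark : Fin n → ℝ` in the fundamental period `Ico 0 1`; the marked
points `boundary (mark i)` are then pairwise distinct and met in this order along the boundary loop.
For `n = 4` this is a topological (conformal) rectangle, for `n = 2` a Dobrushin domain
(Smirnov, C. R. Acad. Sci. 333 (2001); Werner 2007, §2–3). [cite: Werner2007, §2–3] -/
structure MarkedDomain (n : ℕ) extends JordanDomain where
  /-- The boundary parameters of the marked points, in `Ico 0 1`. -/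
  mark : Fin n → ℝ
  /-- The marked parameters are strictly increasing. -/
  strictMono_mark : StrictMono mark
  /-- The marked parameters lie in the fundamental period. -/
  mark_mem : ∀ i, mark i ∈ Ico (0 : ℝ) 1

/-- A **conformal rectangle** (topological rectangle) `(D; a, b, c, d)`: a Jordan domain with four
marked boundary points in cyclic order (Smirnov, C. R. Acad. Sci. 333 (2001); Werner 2007, §3). [cite: Werner2007, §3] -/
abbrev ConformalRectangle := MarkedDomain 4

/-- A **Dobrushin domain** `(D; a, b)`: a Jordan domain with two marked boundary points, splitting
the boundary into two arcs carrying the two boundary conditions (Werner 2007, §2). [cite: Werner2007, §2] -/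
abbrev DobrushinDomain := MarkedDomain 2

namespace MarkedDomain

variable {n m : ℕ} (D : MarkedDomain n)

/-- The `i`-th marked boundary point `boundary (mark i)` (Werner 2007, §2–3). [cite: Werner2007, §2–3] -/
def pt (i : Fin n) : ℂ :=
  D.boundary (D.mark i)

/-- The parameter of the next marked point after `mark i`, cyclically: `mark (i+1)` if `i+1 < n`,
and `mark 0 + 1` (the first mark shifted by the period) for the last index
(Werner 2007, §2–3). [cite: Werner2007, §2–3] -/
def nextMark (i : Fin n) : ℝ :=
  if h : i.val + 1 < n then D.mark ⟨i.val + 1, h⟩ else D.mark ⟨0, by omega⟩ + 1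

/-- Each mark is strictly smaller than the next one (cyclically, using the period). [folklore] -/
theorem mark_lt_nextMark (i : Fin n) : D.mark i < D.nextMark i := by
  unfold nextMark
  split_ifs with h
  · exact D.strictMono_mark (Fin.mk_lt_mk.2 (Nat.lt_succ_self _))
  · have h0 := (D.mark_mem i).2
    have h1 := (D.mark_mem ⟨0, by omega⟩).1
    linarith

/-- The next mark is at most one period after the current one. [folklore] -/
theorem nextMark_le_mark_add_one (i : Fin n) : D.nextMark i ≤ D.mark i + 1 := by
  unfold nextMark
  split_ifs with h
  · have h0 := (D.mark_mem ⟨i.val + 1, h⟩).2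
    have h1 := (D.mark_mem i).1
    linarith
  · have : (⟨0, by omega⟩ : Fin n) ≤ i := Fin.mk_le_mk.2 (Nat.zero_le _)
    simpa using D.strictMono_mark.monotone this

/-- The boundary point at the next mark is the next marked point `pt (i + 1)` (indices mod `n`). [folklore] -/
theorem boundary_nextMark [NeZero n] (i : Fin n) : D.boundary (D.nextMark i) = D.pt (i + 1) := by
  unfold nextMark pt
  split_ifs with h
  · congr 2
    ext
    simp [Fin.val_add, Nat.mod_eq_of_lt h]
  · have hn : i.val + 1 = n := by omega
    rw [D.periodic_boundary]
    congr 2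
    ext
    simp [Fin.val_add, hn]

/-- The `i`-th closed **boundary arc**, from `pt i` to `pt (i+1)` (cyclically): the image of the
parameter interval `Icc (mark i) (nextMark i)`. For a conformal rectangle `(D; a, b, c, d)` the arcs
are `(ab), (bc), (cd), (da)` (Smirnov 2001; Werner 2007, §3). [cite: Smirnov2001] -/
def arc (i : Fin n) : Set ℂ :=
  D.boundary '' Icc (D.mark i) (D.nextMark i)

/-- Marked points lie on the frontier of the domain. [folklore] -/
theorem pt_mem_frontier (i : Fin n) : D.pt i ∈ frontier D.carrier :=
  D.boundary_mem_frontier _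

/-- The marked points are pairwise distinct. [folklore] -/
theorem pt_injective : Function.Injective D.pt := fun i j h ↦
  D.strictMono_mark.injective (D.injOn_boundary (D.mark_mem i) (D.mark_mem j) h)

/-- Boundary arcs are contained in the frontier of the domain. [folklore] -/
theorem arc_subset_frontier (i : Fin n) : D.arc i ⊆ frontier D.carrier := by
  rintro _ ⟨t, -, rfl⟩
  exact D.boundary_mem_frontier t

/-- The arc `arc i` starts at the marked point `pt i`. [folklore] -/
theorem pt_mem_arc_self (i : Fin n) : D.pt i ∈ D.arc i :=
  mem_image_of_mem _ (left_mem_Icc.2 (D.mark_lt_nextMark i).le)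

/-- The arc `arc i` ends at the next marked point `pt (i + 1)` (indices mod `n`). [folklore] -/
theorem pt_succ_mem_arc [NeZero n] (i : Fin n) : D.pt (i + 1) ∈ D.arc i := by
  rw [← D.boundary_nextMark]
  exact mem_image_of_mem _ (right_mem_Icc.2 (D.mark_lt_nextMark i).le)

/-- Boundary arcs are compact (continuous images of compact intervals). [folklore] -/
theorem isCompact_arc (i : Fin n) : IsCompact (D.arc i) :=
  isCompact_Icc.image D.continuous_boundary

/-- Boundary arcs are closed. [folklore] -/
theorem isClosed_arc (i : Fin n) : IsClosed (D.arc i) :=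
  (D.isCompact_arc i).isClosed

/-- The boundary arcs cover the whole frontier (for `n ≥ 1` marked points): the parameter intervals
`Icc (mark i) (nextMark i)` tile one full period `Icc (mark 0) (mark 0 + 1)` (Werner 2007, §3). [cite: Werner2007, §3] -/
def iUnion_arc : Prop :=
  ∀ [NeZero n],
    ⋃ i, D.arc i = frontier D.carrier

/-- Restrict the marking along an order embedding `Fin m ↪o Fin n` (keep a sub-tuple of the marked
points, in the same cyclic order). [folklore] -/
def restrictMarks (D : MarkedDomain n) (f : Fin m ↪o Fin n) : MarkedDomain m where
  toJordanDomain := D.toJordanDomain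
  mark := D.mark ∘ f
  strictMono_mark := D.strictMono_mark.comp f.strictMono
  mark_mem i := D.mark_mem (f i)

/-- The underlying domain is unchanged by restricting the marks. [folklore] -/
@[simp] theorem carrier_restrictMarks (f : Fin m ↪o Fin n) :
    (D.restrictMarks f).carrier = D.carrier := rfl

/-- Marked points of a restricted marking. [folklore] -/
@[simp] theorem pt_restrictMarks (f : Fin m ↪o Fin n) (k : Fin m) :
    (D.restrictMarks f).pt k = D.pt (f k) := rfl

/-- The Dobrushin domain `(D; pt i, pt j)` obtained by keeping two marked points `i < j`; e.g. for a
conformal rectangle `R`, `R.chord 0 2` is `(D; a, c)` whose two arcs are `(abc)` and `(cda)`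
(Werner 2007, §3). [cite: Werner2007, §3] -/
def chord (D : MarkedDomain n) (i j : Fin n) (h : i < j) : DobrushinDomain where
  toJordanDomain := D.toJordanDomain
  mark := ![D.mark i, D.mark j]
  strictMono_mark := by
    refine Fin.strictMono_iff_lt_succ.2 fun k ↦ ?_
    fin_cases k
    simpa using D.strictMono_mark h
  mark_mem k := by fin_cases k <;> simp [D.mark_mem]

/-- The underlying domain of a chord is unchanged. [folklore] -/
@[simp] theorem carrier_chord (i j : Fin n) (h : i < j) : (D.chord i j h).carrier = D.carrier := rfl

/-- The first marked point of `D.chord i j` is `pt i`. [folklore] -/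
@[simp] theorem pt_chord_zero (i j : Fin n) (h : i < j) : (D.chord i j h).pt 0 = D.pt i := rfl

/-- The second marked point of `D.chord i j` is `pt j`. [folklore] -/
@[simp] theorem pt_chord_one (i j : Fin n) (h : i < j) : (D.chord i j h).pt 1 = D.pt j := rfl

end MarkedDomain

/-- The unit disc as a conformal rectangle, with marked points `1, i, -1, -i` (parameters
`0, 1/4, 1/2, 3/4`). Non-vacuity witness for `∀ R : ConformalRectangle, …` statements
(Smirnov 2001; Werner 2007, §3). [cite: Smirnov2001] -/
noncomputable def ConformalRectangle.unitDisc : ConformalRectangle where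
  toJordanDomain := JordanDomain.unitDisc
  mark := ![0, 1 / 4, 1 / 2, 3 / 4]
  strictMono_mark := by
    refine Fin.strictMono_iff_lt_succ.2 fun k ↦ ?_
    fin_cases k <;> simp <;> norm_num
  mark_mem k := by fin_cases k <;> simp <;> norm_num

/-- The unit disc as a Dobrushin domain, with marked points `1, -1` (parameters `0, 1/2`); the two
arcs are the upper and lower half circles (Werner 2007, §2). [cite: Werner2007, §2] -/
noncomputable def DobrushinDomain.unitDisc : DobrushinDomain where
  toJordanDomain := JordanDomain.unitDisc
  mark := ![0, 1 / 2]
  strictMono_mark := by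
    refine Fin.strictMono_iff_lt_succ.2 fun k ↦ ?_
    fin_cases k
    simp
  mark_mem k := by fin_cases k <;> norm_num

/-- Conformal rectangles exist: the unit disc with four marked points. [folklore] -/
instance : Nonempty ConformalRectangle := ⟨ConformalRectangle.unitDisc⟩

/-- Dobrushin domains exist: the unit disc with two marked points. [folklore] -/
instance : Nonempty DobrushinDomain := ⟨DobrushinDomain.unitDisc⟩

end Literature.Probability.RandomPlanarGeometry
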